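import Summits.Ventures.CertifiedManyBodySolver.Downfold.EmeryOneBandImageBand
import Summits.Ventures.CertifiedManyBodySolver.Downfold.EmeryVanHoveLa214
import Summits.Ventures.CertifiedManyBodySolver.Downfold.EmeryBoxesLa214LifshitzX015
import Summits.Ventures.CertifiedManyBodySolver.Downfold.EmeryFermiScalePointsLa214Corners
import HarnessLib

/-!
# THE SIGNS OF THE RIGID DOPING LEVERS ON BOX #18, FOR EVERY MEMBER: hole doping RAISES the one-band nodal `t`, the nodal and Γ–X axis Cu-d weights of EVERY σ row of
# `emeryBoxLa214v123` at EVERY pair of fillings `0 < ν ≤ ν′ ≤ 1/2`, and the zone-face antinodal weight on the hole-like range (INFL-3to1-B §B.98 (h); kernel `EmeryOneBandImageBand`)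

Venture CertifiedManyBodySolver, cell `pub/hubbard-downfold` (stage S1), seat hubbard-downfold-mod-4 (technique B, g43); namespace `Summit.Ventures.CertifiedManyBodySolver.Downfold.Emery`.
Everything PROVED (0 sorry; no certificate beyond the landed half-filling bracket `cornerPt_la214BoxHi_x0_br` and the van Hove floors `la214Box_xVH` / `la214DFTBox_xVH_ge`).
§B.64 (d)(iii) certified the rigid doping lever on the SCALE per printed σ set (+3 … +5 % per 0.1 hole); here its SIGN is a theorem for every member of the typed box and every pair
of fillings on the hole side of half filling — the qualitative content of the column-by-column drift of §B.88–§B.97 (every window end moves monotonically with x).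
WHAT THIS IS NOT: a statement about La₂₋ₓSrₓCuO₄ — the typed box is SCREENING-GRADE; `U = 0` one-body kinematics of the σ model (rigid band); a SIGN, not a size; no U number.

* `la214Box_scale_anti_filling` — `0 < ν ≤ ν′ ≤ 1/2 ⇒ t_node(θ; ν′) ≤ t_node(θ; ν)` (fewer electrons = more holes ⇒ larger t) for every member;
* `la214Box_dWeightNode_anti_filling`, `la214Box_dWeightAxis_anti_filling` — the same for the nodal and the Γ–X axis Cu-d weights;
* `la214Box_dWeightFace_anti_filling` — the zone-face antinodal weight on `7/16 ≤ ν ≤ ν′ ≤ 1/2` (x ≤ 1/8, every member hole-like); `la214DFTBox_dWeightFace_anti_filling` on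
  `17/40 ≤ ν` (x ≤ 0.15) for the DFT-level tag.

Sources: three-band model [HybertsenSchluterChristensen1989, Eq. (1)]; [AndersenEtAl1995, §6]; [folklore] algebra.
-/

noncomputable section

namespace Summit.Ventures.CertifiedManyBodySolver.Downfold.Emery

open Real Set

/-- The box-wide Fermi-energy ceiling of box #18 on the hole side of half filling: `0 < ν ≤ 1/2 ⇒ ε_F(θ; ν) ≤ 487/200` for every member (two-corner rule + the landed K = 384
bracket `cornerPt_la214BoxHi_x0_br` at the corner (1.7, 1.52, 0.66, 0.12), ν = 1/2). [folklore] -/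
theorem la214Box_fermiEnergyOf_le_ceiling {Δ a b c ν : ℝ} (hΔ : Δ ∈ Icc ((17 : ℝ) / 10) (4 : ℝ)) (ha : a ∈ Icc ((129 : ℝ) / 100) ((38 : ℝ) / 25)) (hb : b ∈ Icc ((23 : ℝ) / 50) ((33 : ℝ) / 50))
    (hc : c ∈ Icc ((3 : ℝ) / 25) ((3 : ℝ) / 20)) (hν0 : 0 < ν) (hν : ν ≤ (1 : ℝ) / 2) : fermiEnergyOf Δ a b c ν ≤ (487 : ℝ) / 200 := by
  have hΔ0 : 0 < Δ := lt_of_lt_of_le (by norm_num) hΔ.1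
  have ha0 : 0 < a := lt_of_lt_of_le (by norm_num) ha.1
  have hc0 : 0 ≤ c := le_trans (by norm_num) hc.1
  have hb0 : 0 ≤ b := le_trans (by norm_num) hb.1
  have hT := (fermiEnergyOf_of_pointBracketCheck cornerPt_la214BoxHi_x0_br (by norm_num) (by norm_num) (by norm_num) (ν := (1/2 : ℝ)) (by push_cast; exact ⟨le_rfl, le_rfl⟩)).2
  push_cast at hT
  have hbox := fermiEnergyOf_mem_Icc_of_mem_box' (ν := ((1 : ℝ) / 2)) (by norm_num) (by norm_num) (by norm_num) (by norm_num) hΔ ha hb hc (by norm_num) (by norm_num)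
  have hhalf : ((1 : ℝ) / 2) = (1/2 : ℝ) := by norm_num
  have hEh0 : fermiEnergyOf Δ a b c ((1 : ℝ) / 2) ≤ (487 : ℝ) / 200 := by
    refine hbox.2.trans ?_
    rw [hhalf]; exact hT.2
  exact fermiEnergyOf_le_of_band (ν₂ := ((1 : ℝ) / 2)) hΔ0 ha0.ne' hc0 hb0 hν0 hν (by norm_num) hEh0

/-- **HOLE DOPING RAISES THE ONE-BAND NODAL `t` OF EVERY MEMBER OF BOX #18**: `0 < ν ≤ ν′ ≤ 1/2 ⇒ t_node(θ; ε_F(ν′)) ≤ t_node(θ; ε_F(ν))`. [folklore] -/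
theorem la214Box_scale_anti_filling {Δ a b c ν ν' : ℝ} (hΔ : Δ ∈ Icc ((17 : ℝ) / 10) (4 : ℝ)) (ha : a ∈ Icc ((129 : ℝ) / 100) ((38 : ℝ) / 25)) (hb : b ∈ Icc ((23 : ℝ) / 50) ((33 : ℝ) / 50))
    (hc : c ∈ Icc ((3 : ℝ) / 25) ((3 : ℝ) / 20)) (hν0 : 0 < ν) (hνν : ν ≤ ν') (hν' : ν' ≤ (1 : ℝ) / 2) :
    scaleT Δ a b c (xNode Δ a b c (fermiEnergyOf Δ a b c ν')) (xNode Δ a b c (fermiEnergyOf Δ a b c ν')) (fermiEnergyOf Δ a b c ν') ≤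
      scaleT Δ a b c (xNode Δ a b c (fermiEnergyOf Δ a b c ν)) (xNode Δ a b c (fermiEnergyOf Δ a b c ν)) (fermiEnergyOf Δ a b c ν) := by
  have hΔ0 : 0 < Δ := lt_of_lt_of_le (by norm_num) hΔ.1
  have ha0 : 0 < a := lt_of_lt_of_le (by norm_num) ha.1
  have hc0 : 0 ≤ c := le_trans (by norm_num) hc.1
  have hcb : c ≤ b := hc.2.trans (le_trans (by norm_num) hb.1)
  have hb0 : 0 ≤ b := hc0.trans hcb
  have hEh := la214Box_fermiEnergyOf_le_ceiling hΔ ha hb hc (lt_of_lt_of_le hν0 hνν) hν'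
  have ha2 : ((129 : ℝ) / 100) ^ 2 ≤ a ^ 2 := pow_le_pow_left₀ (by norm_num) ha.1 2
  have hm : c * fermiEnergyOf Δ a b c ν' < a ^ 2 :=
    lt_of_le_of_lt (mul_le_mul_of_nonneg_left hEh hc0) (by nlinarith [hc.2])
  have hq : b * Δ < 4 * a ^ 2 := by nlinarith [mul_le_mul hb.2 hΔ.2 hΔ0.le (by norm_num : (0 : ℝ) ≤ (33 : ℝ) / 50)]
  exact scaleT_node_fermiEnergyOf_anti_filling hΔ0 ha0.ne' hc0 hcb hν0 hνν (lt_of_le_of_lt hν' (by norm_num)) hm hq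

/-- **HOLE DOPING RAISES THE NODAL Cu-d WEIGHT OF EVERY MEMBER OF BOX #18**: `0 < ν ≤ ν′ ≤ 1/2 ⇒ w_node(θ; ν′) ≤ w_node(θ; ν)`. [folklore] -/
theorem la214Box_dWeightNode_anti_filling {Δ a b c ν ν' : ℝ} (hΔ : Δ ∈ Icc ((17 : ℝ) / 10) (4 : ℝ)) (ha : a ∈ Icc ((129 : ℝ) / 100) ((38 : ℝ) / 25))
    (hb : b ∈ Icc ((23 : ℝ) / 50) ((33 : ℝ) / 50)) (hc : c ∈ Icc ((3 : ℝ) / 25) ((3 : ℝ) / 20)) (hν0 : 0 < ν) (hνν : ν ≤ ν') (hν' : ν' ≤ (1 : ℝ) / 2) :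
    dWeightNode Δ a b c (fermiEnergyOf Δ a b c ν') ≤ dWeightNode Δ a b c (fermiEnergyOf Δ a b c ν) := by
  have hΔ0 : 0 < Δ := lt_of_lt_of_le (by norm_num) hΔ.1
  have ha0 : 0 < a := lt_of_lt_of_le (by norm_num) ha.1
  have hc0 : 0 ≤ c := le_trans (by norm_num) hc.1
  have hcb : c ≤ b := hc.2.trans (le_trans (by norm_num) hb.1)
  exact dWeightNode_fermiEnergyOf_anti_filling hΔ0 ha0.ne' hc0 hcb hν0 hνν (lt_of_le_of_lt hν' (by norm_num))

/-- **HOLE DOPING RAISES THE Γ–X AXIS Cu-d WEIGHT OF EVERY MEMBER OF BOX #18** (any topology; the axis state at the Fermi energy): `0 < ν ≤ ν′ ≤ 1/2 ⇒ w_axis(θ; ν′) ≤ w_axis(θ; ν)`. [folklore] -/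
theorem la214Box_dWeightAxis_anti_filling {Δ a b c ν ν' : ℝ} (hΔ : Δ ∈ Icc ((17 : ℝ) / 10) (4 : ℝ)) (ha : a ∈ Icc ((129 : ℝ) / 100) ((38 : ℝ) / 25))
    (hb : b ∈ Icc ((23 : ℝ) / 50) ((33 : ℝ) / 50)) (hc : c ∈ Icc ((3 : ℝ) / 25) ((3 : ℝ) / 20)) (hν0 : 0 < ν) (hνν : ν ≤ ν') (hν' : ν' ≤ (1 : ℝ) / 2) :
    dWeightAxis Δ a b c (fermiEnergyOf Δ a b c ν') ≤ dWeightAxis Δ a b c (fermiEnergyOf Δ a b c ν) := by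
  have hΔ0 : 0 < Δ := lt_of_lt_of_le (by norm_num) hΔ.1
  have ha0 : 0 < a := lt_of_lt_of_le (by norm_num) ha.1
  have hc0 : 0 ≤ c := le_trans (by norm_num) hc.1
  have hcb : c ≤ b := hc.2.trans (le_trans (by norm_num) hb.1)
  have hb0 : 0 ≤ b := hc0.trans hcb
  have hEh := la214Box_fermiEnergyOf_le_ceiling hΔ ha hb hc (lt_of_lt_of_le hν0 hνν) hν'
  have ha2 : ((129 : ℝ) / 100) ^ 2 ≤ a ^ 2 := pow_le_pow_left₀ (by norm_num) ha.1 2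
  have hm : c * ((487 : ℝ) / 200) < a ^ 2 := by nlinarith [hc.2]
  have hcΔ : c * Δ ≤ ((3 : ℝ) / 20) * Δ := mul_le_mul_of_nonneg_right hc.2 hΔ0.le
  have hlev : c * (2 * Δ * ((487 : ℝ) / 200) + ((487 : ℝ) / 200) ^ 2) ≤ a ^ 2 * Δ := by nlinarith [hc.2, hΔ.1, hc0]
  exact (dWeightAxis_fermiEnergyOf_band hΔ0 ha0.ne' hc0 hb0 hν0 (show ν' ∈ Icc ν ν' from ⟨hνν, le_rfl⟩) (lt_of_le_of_lt hν' (by norm_num)) hEh hm hlev).2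

/-- **HOLE DOPING RAISES THE ZONE-FACE ANTINODAL Cu-d WEIGHT OF EVERY MEMBER OF BOX #18 ON THE HOLE-LIKE RANGE x ≤ 1/8**: `7/16 ≤ ν ≤ ν′ ≤ 1/2 ⇒ w_face(θ; ν′) ≤ w_face(θ; ν)`
(every member hole-like at ν: `1 − 2ν ≤ 1/8 < 0.1344 ≤ x_VH`, `la214Box_xVH`). [folklore] -/
theorem la214Box_dWeightFace_anti_filling {Δ a b c ν ν' : ℝ} (hΔ : Δ ∈ Icc ((17 : ℝ) / 10) (4 : ℝ)) (ha : a ∈ Icc ((129 : ℝ) / 100) ((38 : ℝ) / 25))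
    (hb : b ∈ Icc ((23 : ℝ) / 50) ((33 : ℝ) / 50)) (hc : c ∈ Icc ((3 : ℝ) / 25) ((3 : ℝ) / 20)) (hν0 : (7 : ℝ) / 16 ≤ ν) (hνν : ν ≤ ν') (hν' : ν' ≤ (1 : ℝ) / 2) :
    dWeightFace Δ a b c (fermiEnergyOf Δ a b c ν') ≤ dWeightFace Δ a b c (fermiEnergyOf Δ a b c ν) := by
  have hΔ0 : 0 < Δ := lt_of_lt_of_le (by norm_num) hΔ.1
  have ha0 : 0 < a := lt_of_lt_of_le (by norm_num) ha.1
  have hc0 : 0 ≤ c := le_trans (by norm_num) hc.1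
  have hcb : c ≤ b := hc.2.trans (le_trans (by norm_num) hb.1)
  have hν0' : 0 < ν := lt_of_lt_of_le (by norm_num) hν0
  have hEh := la214Box_fermiEnergyOf_le_ceiling hΔ ha hb hc (lt_of_lt_of_le hν0' hνν) hν'
  have ha2 : ((129 : ℝ) / 100) ^ 2 ≤ a ^ 2 := pow_le_pow_left₀ (by norm_num) ha.1 2
  have hm : c * ((487 : ℝ) / 200) < a ^ 2 := by nlinarith [hc.2]
  have hU : 0 ≤ faceU Δ a b c ((487 : ℝ) / 200) :=
    faceU_nonneg_on_box4 (Δ₁ := ((17 : ℝ) / 10)) (Δ₂ := (4 : ℝ)) (a₁ := ((129 : ℝ) / 100)) (b₁ := ((23 : ℝ) / 50)) (c₁ := ((3 : ℝ) / 25)) (c₂ := ((3 : ℝ) / 20))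
      (by norm_num) (by norm_num) (by norm_num) (by norm_num) (by norm_num) hΔ ha.1 hb.1 hc
      (by norm_num [faceU_eq]) (by norm_num [faceU_eq]) (by norm_num [faceU_eq]) (by norm_num [faceU_eq])
  have hx : (9911 / 73728 : ℝ) ≤ xVH Δ a b c := (la214Box_xVH hΔ (by simpa using ha) (by simpa using hb) (by simpa using hc)).2.2.2.1
  have hxν : 1 - 2 * ν ≤ xVH Δ a b c := le_trans (by linarith) hx
  exact dWeightFace_fermiEnergyOf_anti_filling hΔ0 ha0 hc0 hcb hν0' hνν (lt_of_le_of_lt hν' (by norm_num)) hxν hEh hm hU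

/-- **The same on the DFT-level tag down to x = 0.15**: `Δ_pd ≤ 2.91`, `17/40 ≤ ν ≤ ν′ ≤ 1/2 ⇒ w_face(θ; ν′) ≤ w_face(θ; ν)` (`la214DFTBox_xVH_ge`: x_VH ≥ 0.155). [folklore] -/
theorem la214DFTBox_dWeightFace_anti_filling {Δ a b c ν ν' : ℝ} (hΔ : Δ ∈ Icc ((17 : ℝ) / 10) ((291 : ℝ) / 100)) (ha : a ∈ Icc ((129 : ℝ) / 100) ((38 : ℝ) / 25))
    (hb : b ∈ Icc ((23 : ℝ) / 50) ((33 : ℝ) / 50)) (hc : c ∈ Icc ((3 : ℝ) / 25) ((3 : ℝ) / 20)) (hν0 : (17 : ℝ) / 40 ≤ ν) (hνν : ν ≤ ν') (hν' : ν' ≤ (1 : ℝ) / 2) :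
    dWeightFace Δ a b c (fermiEnergyOf Δ a b c ν') ≤ dWeightFace Δ a b c (fermiEnergyOf Δ a b c ν) := by
  have hΔ0 : 0 < Δ := lt_of_lt_of_le (by norm_num) hΔ.1
  have ha0 : 0 < a := lt_of_lt_of_le (by norm_num) ha.1
  have hc0 : 0 ≤ c := le_trans (by norm_num) hc.1
  have hcb : c ≤ b := hc.2.trans (le_trans (by norm_num) hb.1)
  have hν0' : 0 < ν := lt_of_lt_of_le (by norm_num) hν0
  have hΔw : Δ ∈ Icc ((17 : ℝ) / 10) (4 : ℝ) := ⟨hΔ.1, le_trans hΔ.2 (by norm_num)⟩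
  have hEh := la214Box_fermiEnergyOf_le_ceiling hΔw ha hb hc (lt_of_lt_of_le hν0' hνν) hν'
  have ha2 : ((129 : ℝ) / 100) ^ 2 ≤ a ^ 2 := pow_le_pow_left₀ (by norm_num) ha.1 2
  have hm : c * ((487 : ℝ) / 200) < a ^ 2 := by nlinarith [hc.2]
  have hU : 0 ≤ faceU Δ a b c ((487 : ℝ) / 200) :=
    faceU_nonneg_on_box4 (Δ₁ := ((17 : ℝ) / 10)) (Δ₂ := ((291 : ℝ) / 100)) (a₁ := ((129 : ℝ) / 100)) (b₁ := ((23 : ℝ) / 50)) (c₁ := ((3 : ℝ) / 25)) (c₂ := ((3 : ℝ) / 20))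
      (by norm_num) (by norm_num) (by norm_num) (by norm_num) (by norm_num) hΔ ha.1 hb.1 hc
      (by norm_num [faceU_eq]) (by norm_num [faceU_eq]) (by norm_num [faceU_eq]) (by norm_num [faceU_eq])
  have hx : 1 - 2 * ((62300 : ℝ) / 147456) ≤ xVH Δ a b c := la214DFTBox_xVH_ge hΔ ha hb hc
  have hxν : 1 - 2 * ν ≤ xVH Δ a b c := le_trans (by linarith) hx
  exact dWeightFace_fermiEnergyOf_anti_filling hΔ0 ha0 hc0 hcb hν0' hνν (lt_of_le_of_lt hν' (by norm_num)) hxν hEh hm hU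

end Summit.Ventures.CertifiedManyBodySolver.Downfold.Emery
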